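import Summits.HodgeConjecture.HodgeConjecture.Cruxes.BlochSeedDiscOne.BnCCertCover2

/-!
# BnCCertCover3 — module 3 of the «v1 + L1(.5) + ℤ + S + O» B&B certificate checker (dual g12, 2026-08-30): replay groundwork for ORDERED leaves

Module 1 `BnCCertCover.lean` (v4 d0917058c35b) and module 2 `BnCCertCover2.lean` (3348eb08ff92) hold the checker and its soundness theorems.  This module
(gate10 standing rule: new growth in NEW sibling modules < 200 kB) starts the REPLAY side for ordered leaves: §39 the COLUMN-CHUNKED ordered pointwise pass
(`ordCols` ∕ `ordColsD` (per-type deduplicated orderings: region 4273 = 2 555 P + 4 941 N columns, kernel-confirmed at scratch), `ptOKO`, `checkPtO_of_all` ∕ `checkPtO_of_allD`, the `take`∕`drop` chunk chain `all_of_drop_zero` ∕ `all_drop_of_chunk` ∕ `all_drop_of_length_le`, `checkLeafO_intro`) —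
needed because an ordered leaf of a whole cap region (region 4273: 7 496 ordered columns) does not fit one `decide`.  The first certificate to replay through
`regionPathEmpty_of_chunksO'` is `ideators∕plan-lens-HodgeAV-dual∕g12∕replay4273∕cert4273-m3b-present-otl1.v2.json` (FORMAT-v1L1.md §9.4); its data and chunk
lemmas go in further sibling modules.  Typed rc 0 at scratch as an append to modules 1+2 (`BnCCertCover-v8-scratch.lean`, with the §40 probe of the real certificate: `checkCoreO` ✓, universe sizes ✓, a 240-column chunk ✓).
Nothing here is a certificate or a region theorem; nothing toward `FloorFree 6 199 8` ∕ 18881 ∕ HC.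
-/

set_option linter.dupNamespace false
set_option autoImplicit false

namespace Summit.HodgeConjecture.HodgeConjecture.Cruxes.BlochSeedDiscOne.BnCCertCover

open Summit.HodgeConjecture.HodgeConjecture.Cruxes.BlochSeedDiscOne.DepthBoundA4
open Summit.HodgeConjecture.HodgeConjecture.Cruxes.BlochSeedDiscOne.RingFiveEmpty
open Summit.HodgeConjecture.HodgeConjecture.Cruxes.BlochSeedDiscOne.BnCCert

/-! ## §39 (module-3 groundwork, typed at scratch) COLUMN-CHUNKED ordered pointwise pass
§§6∕8∕9's «chunks» are one lemma PER LEAF; an ordered leaf of a whole cap region (region 4273: 7 496 ordered columns × ≈ 120 rows) does not fit one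
`decide`, so the pass `checkPtO` is exposed as `List.all` over the flat column list `ordCols` and assembled from `take`∕`drop` chunks; `checkLeafO_intro`
assembles the leaf check from `checkCoreO` and the two passes.  Nothing here is a certificate; nothing toward `FloorFree 6 199 8`. -/
section ChunkO

/-- the ordered pointwise predicate of `checkPtO` on ONE ordered column -/
def ptOKO (E : List (Var × VarRec)) (γ : Coefs) (L ρ : ℤ) (bans : List (Side × STuple)) (pres : List Pres)
    (kbans : List KLit) (kpres : List KPres) (ephi : List EPhi) (orows : List ERow) (X : Side → STuple → ℤ) (oskip : Side → STuple → Bool)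
    (sd : Side) (t : STuple) : Bool :=
  ((banHit bans sd t || decide (0 < emptyCnt sd kbans t)) || oskip sd t) ||
    decide (sd.sgn * (Gtype γ t + erVal orows t) + coverPay E sd t + presPay pres sd t + QK sd ephi kpres kbans t + X sd t ≤ sd.bnd L ρ)

/-- the flat list of admissible ORDERED columns of a side (every ordering of every sorted admissible type) -/
def ordCols (h : ℕ) (bs : List Bound) (sd : Side) : List STuple := (admTypesSorted h bs sd).flatMap ordsOf

theorem checkPtO_of_all {h : ℕ} {bs : List Bound} {E : List (Var × VarRec)} {γ : Coefs} {L ρ : ℤ} {bans : List (Side × STuple)} {pres : List Pres}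
    {kbans : List KLit} {kpres : List KPres} {ephi : List EPhi} {orows : List ERow} {X : Side → STuple → ℤ} {oskip : Side → STuple → Bool} {sd : Side}
    (hall : (ordCols h bs sd).all (ptOKO E γ L ρ bans pres kbans kpres ephi orows X oskip sd) = true) :
    checkPtO h bs E γ L ρ bans pres kbans kpres ephi orows X oskip sd = true := by
  simp only [ordCols, List.all_eq_true, List.mem_flatMap, forall_exists_index, and_imp] at hall
  simp only [checkPtO, List.all_eq_true]
  intro τ hτ t ht
  exact hall t τ hτ ht

/-- chunk assembly: columns `[i, i+n)` checked and columns `≥ i+n` checked ⇒ columns `≥ i` checked -/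
theorem all_drop_of_chunk {α : Type} (p : α → Bool) (l : List α) (i n : ℕ)
    (h1 : ((l.drop i).take n).all p = true) (h2 : (l.drop (i + n)).all p = true) : (l.drop i).all p = true := by
  have h2' : ((l.drop i).drop n).all p = true := by
    simpa [List.drop_drop, Nat.add_comm] using h2
  rw [← List.take_append_drop n (l.drop i), List.all_append, h1, h2']
  rfl

/-- start of the chunk chain -/
theorem all_of_drop_zero {α : Type} (p : α → Bool) (l : List α) (h : (l.drop 0).all p = true) : l.all p = true := by
  simpa using h

/-- end of the chunk chain: past the end of the list nothing is left to check -/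
theorem all_drop_of_length_le {α : Type} (p : α → Bool) (l : List α) (i : ℕ) (h : l.length ≤ i) : (l.drop i).all p = true := by
  simp [List.drop_eq_nil_of_le h]

/-- the flat list of admissible ordered columns with the per-type orderings DEDUPLICATED (`ordsOf` lists 24 orderings with repetitions; a type with a
stabiliser of order `s` contributes `24∕s` distinct columns) — region 4273: 2 555 P + 4 941 N columns instead of 4 224 + 8 136 visits -/
def ordColsD (h : ℕ) (bs : List Bound) (sd : Side) : List STuple := (admTypesSorted h bs sd).flatMap fun τ => (ordsOf τ).dedup

theorem checkPtO_of_allD {h : ℕ} {bs : List Bound} {E : List (Var × VarRec)} {γ : Coefs} {L ρ : ℤ} {bans : List (Side × STuple)} {pres : List Pres}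
    {kbans : List KLit} {kpres : List KPres} {ephi : List EPhi} {orows : List ERow} {X : Side → STuple → ℤ} {oskip : Side → STuple → Bool} {sd : Side}
    (hall : (ordColsD h bs sd).all (ptOKO E γ L ρ bans pres kbans kpres ephi orows X oskip sd) = true) :
    checkPtO h bs E γ L ρ bans pres kbans kpres ephi orows X oskip sd = true := by
  simp only [ordColsD, List.all_eq_true, List.mem_flatMap, forall_exists_index, and_imp] at hall
  simp only [checkPtO, List.all_eq_true]
  intro τ hτ t ht
  exact hall t τ hτ (List.mem_dedup.mpr ht)

/-- assemble the ordered leaf check from its parts (the two passes may themselves come from chunks via `checkPtO_of_all`) -/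
theorem checkLeafO_intro (C : CertO) (lf : LeafO) (γ : Coefs) (hf : lf.n.m.core.base.func = Func.cls γ) (hcore : checkCoreO C lf = true)
    (hN : checkPtO C.h (allBounds C.vars lf.n.m.core.base) (ents C.vars lf.n.m.core.base) γ lf.n.m.core.base.L lf.n.m.core.base.ρ lf.n.m.core.bans
        (lf.n.m.presEff C.B) lf.n.m.core.kbans lf.n.m.core.kpres lf.n.m.core.ephi lf.orows (lf.X C.B) (obanHit lf.obans) Side.N = true)
    (hP : checkPtO C.h (allBounds C.vars lf.n.m.core.base) (ents C.vars lf.n.m.core.base) γ lf.n.m.core.base.L lf.n.m.core.base.ρ lf.n.m.core.bans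
        (lf.n.m.presEff C.B) lf.n.m.core.kbans lf.n.m.core.kpres lf.n.m.core.ephi lf.orows (lf.X C.B) (obanHit lf.obans) Side.P = true) :
    checkLeafO C lf = true := by
  unfold checkLeafO
  rw [hf]
  simp only [hcore, hN, hP, Bool.and_self]

/-- smoke: the chunk chain on a toy list (chunks of 2 over 5 elements) -/
example : ([1, 2, 3, 4, 5] : List ℕ).all (fun k => decide (k < 9)) = true :=
  all_of_drop_zero _ _ <|
    all_drop_of_chunk _ _ 0 2 (by decide) <|
    all_drop_of_chunk _ _ 2 2 (by decide) <|
    all_drop_of_chunk _ _ 4 2 (by decide) <|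
    all_drop_of_length_le _ _ 6 (by decide)

end ChunkO

end Summit.HodgeConjecture.HodgeConjecture.Cruxes.BlochSeedDiscOne.BnCCertCover
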